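import Summits.CriticalPhenomena.CardyFormulaZ2.Theorems.CardyComplexConeSLESixFamiliesGiveCardySmoothMarkFamiliesPart1
import HarnessLib

/-!
# Smooth-mark discretisation families, part 2: the local epigraph analysis in a lattice frame

Helper file for stub `stub_smoothMarkFamilies` of line `collar-touch-sandwich` of crux
`SLESixFamiliesGiveCardy` (stmt-CriticalPhenomena-9654).

Standing hypotheses (explicit section variables, no bundled predicate): discrete Dobrushin data
`E = ⟨Ω, δ, _, _⟩`; a lattice frame `(k, s, t)` with complex frame vectors
`U = Site.toComplex (Pi.single k s)`, `V = Site.toComplex (Pi.single k.rev t)`; inside `B(p, R)` the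
set `Ω` is the strict epigraph `{a U + b V : G a < b}` of a monotone `1`-Lipschitz `G`, the mark is
`p = α U + G α V`; the mesh is small (`32 δ ≤ R`); the sites of the band `|a - α| ≤ R/4`,
`3R/8 ≤ b - G α ≤ R/2` belong to `meshDomain` (bulk input, discharged later by the Jordan bulk
lemma); `N j = ⌊G (δ j) / δ⌋ + 1` is the bottom row of frame column `j`.  We prove the STAIRCASE
description of `Ω_δ` near `p`: epigraph sites near `p` are in `Ω_δ` (vertical mesh paths to the
band), `Ω_δ`-adjacency of neighbouring epigraph sites, the inner-face criterion `N (j+1) ≤ m`, and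
the bound `row x ≤ N (col x + 1)` for sites of `zdBoundary` near `p`.
-/

noncomputable section

open Set Metric
open Literature.Probability Literature.Probability.RandomPlanarGeometry
  Literature.Probability.LatticeModels Literature.Probability.Percolation

namespace Summit.CriticalPhenomena.CardyFormulaZ2.Cruxes.SLESixFamiliesGiveCardy.CollarTouchSandwich

namespace SmoothMark

/-! ### Frame vectors as abstract complex numbers -/

section FrameVec

variable {k : Fin 2} {s t : ℤ} {U V : ℂ} (hs : s = 1 ∨ s = -1) (ht : t = 1 ∨ t = -1)
  (hU : U = Site.toComplex (Pi.single k s)) (hV : V = Site.toComplex (Pi.single k.rev t))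

include hs ht hU hV in
/-- The mesh point of `x` is `δ (col x) U + δ (row x) V`. [folklore] -/
theorem meshPoint_eq_frame (δ : ℝ) (x : Site 2) :
    meshPoint δ x = ((δ * (s * x k) : ℝ) : ℂ) * U + ((δ * (t * x k.rev) : ℝ) : ℂ) * V := by
  rw [hU, hV, meshPoint_frame k hs ht δ x]; push_cast; rfl

include hs ht hU hV in
/-- Orthonormality of the frame vectors. [folklore] -/
theorem norm_sq_frame (a b : ℝ) : ‖(a : ℂ) * U + (b : ℂ) * V‖ ^ 2 = a ^ 2 + b ^ 2 := by
  rw [hU, hV]; exact frame_norm_sq k hs ht a b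

include hs ht hU hV in
/-- Distances between frame points. [folklore] -/
theorem dist_sq_frame (a b a' b' : ℝ) :
    dist ((a : ℂ) * U + (b : ℂ) * V) ((a' : ℂ) * U + (b' : ℂ) * V) ^ 2 = (a - a') ^ 2 + (b - b') ^ 2 := by
  rw [dist_eq_norm, ← norm_sq_frame hs ht hU hV]
  congr 2; push_cast; ring

include hs ht hU hV in
/-- Coordinate differences are bounded by the distance. [folklore] -/
theorem abs_sub_le_dist_frame (a b a' b' : ℝ) :
    |a - a'| ≤ dist ((a : ℂ) * U + (b : ℂ) * V) ((a' : ℂ) * U + (b' : ℂ) * V) ∧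
      |b - b'| ≤ dist ((a : ℂ) * U + (b : ℂ) * V) ((a' : ℂ) * U + (b' : ℂ) * V) := by
  have h := dist_sq_frame hs ht hU hV a b a' b'
  constructor
  · exact abs_le_of_sq_le_sq (by rw [h]; nlinarith [sq_nonneg (b - b')]) dist_nonneg
  · exact abs_le_of_sq_le_sq (by rw [h]; nlinarith [sq_nonneg (a - a')]) dist_nonneg

include hs ht hU hV in
/-- The distance is bounded by the sum of the coordinate differences. [folklore] -/
theorem dist_le_abs_add_abs_frame (a b a' b' : ℝ) :
    dist ((a : ℂ) * U + (b : ℂ) * V) ((a' : ℂ) * U + (b' : ℂ) * V) ≤ |a - a'| + |b - b'| := by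
  have h := dist_sq_frame hs ht hU hV a b a' b'
  refine le_of_sq_le_sq ?_ (by positivity)
  rw [h]
  nlinarith [abs_nonneg (a - a'), abs_nonneg (b - b'), sq_abs (a - a'), sq_abs (b - b')]

include hs ht hU hV in
/-- Mesh points of sites whose frame coordinates differ by at most one are within `2δ` (`0 ≤ δ`).
[folklore] -/
theorem dist_meshPoint_le_frame {δ : ℝ} (hδ : 0 ≤ δ) {x y : Site 2} (h1 : |s * y k - s * x k| ≤ 1)
    (h2 : |t * y k.rev - t * x k.rev| ≤ 1) : dist (meshPoint δ y) (meshPoint δ x) ≤ 2 * δ := by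
  rw [meshPoint_eq_frame hs ht hU hV, meshPoint_eq_frame hs ht hU hV]
  refine (dist_le_abs_add_abs_frame hs ht hU hV _ _ _ _).trans ?_
  have h1' : |((s * y k : ℤ) : ℝ) - (s * x k : ℤ)| ≤ 1 := by
    rw [← Int.cast_sub, ← Int.cast_abs]; exact_mod_cast h1
  have h2' : |((t * y k.rev : ℤ) : ℝ) - (t * x k.rev : ℤ)| ≤ 1 := by
    rw [← Int.cast_sub, ← Int.cast_abs]; exact_mod_cast h2
  push_cast at h1' h2'
  have e1 : |δ * (s * y k) - δ * (s * x k)| ≤ δ := by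
    rw [← mul_sub, abs_mul, abs_of_nonneg hδ]; nlinarith [abs_nonneg ((s : ℝ) * y k - s * x k)]
  have e2 : |δ * (t * y k.rev) - δ * (t * x k.rev)| ≤ δ := by
    rw [← mul_sub, abs_mul, abs_of_nonneg hδ]; nlinarith [abs_nonneg ((t : ℝ) * y k.rev - t * x k.rev)]
  linarith

/-- A vertical frame segment lies in `S` if its points that lie in the convex set `B ∋` endpoints
do. [folklore] -/
theorem segment_vert_subset {S B : Set ℂ} (hB : Convex ℝ B) {a b₁ b₂ : ℝ}
    (hP : (a : ℂ) * U + (b₁ : ℂ) * V ∈ B) (hQ : (a : ℂ) * U + (b₂ : ℂ) * V ∈ B)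
    (h : ∀ b' : ℝ, min b₁ b₂ ≤ b' → b' ≤ max b₁ b₂ → (a : ℂ) * U + (b' : ℂ) * V ∈ B →
      (a : ℂ) * U + (b' : ℂ) * V ∈ S) :
    segment ℝ ((a : ℂ) * U + (b₁ : ℂ) * V) ((a : ℂ) * U + (b₂ : ℂ) * V) ⊆ S := by
  intro z hz
  have hzB : z ∈ B := hB.segment_subset hP hQ hz
  rw [segment_eq_image] at hz
  obtain ⟨θ, ⟨h0, h1⟩, rfl⟩ := hz
  dsimp only at hzB ⊢
  have he : (1 - θ) • ((a : ℂ) * U + (b₁ : ℂ) * V) + θ • ((a : ℂ) * U + (b₂ : ℂ) * V) =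
      (a : ℂ) * U + (((1 - θ) * b₁ + θ * b₂ : ℝ) : ℂ) * V := by
    simp only [Complex.real_smul]; push_cast; ring
  rw [he] at hzB ⊢
  refine h _ ?_ ?_ hzB
  · have := min_le_left b₁ b₂; have := min_le_right b₁ b₂; nlinarith
  · have := le_max_left b₁ b₂; have := le_max_right b₁ b₂; nlinarith

/-- A horizontal frame segment lies in `S` if its points that lie in the convex set `B ∋` endpoints
do. [folklore] -/
theorem segment_horiz_subset {S B : Set ℂ} (hB : Convex ℝ B) {a₁ a₂ b : ℝ}
    (hP : (a₁ : ℂ) * U + (b : ℂ) * V ∈ B) (hQ : (a₂ : ℂ) * U + (b : ℂ) * V ∈ B)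
    (h : ∀ a' : ℝ, min a₁ a₂ ≤ a' → a' ≤ max a₁ a₂ → (a' : ℂ) * U + (b : ℂ) * V ∈ B →
      (a' : ℂ) * U + (b : ℂ) * V ∈ S) :
    segment ℝ ((a₁ : ℂ) * U + (b : ℂ) * V) ((a₂ : ℂ) * U + (b : ℂ) * V) ⊆ S := by
  intro z hz
  have hzB : z ∈ B := hB.segment_subset hP hQ hz
  rw [segment_eq_image] at hz
  obtain ⟨θ, ⟨h0, h1⟩, rfl⟩ := hz
  dsimp only at hzB ⊢
  have he : (1 - θ) • ((a₁ : ℂ) * U + (b : ℂ) * V) + θ • ((a₂ : ℂ) * U + (b : ℂ) * V) =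
      (((1 - θ) * a₁ + θ * a₂ : ℝ) : ℂ) * U + (b : ℂ) * V := by
    simp only [Complex.real_smul]; push_cast; ring
  rw [he] at hzB ⊢
  refine h _ ?_ ?_ hzB
  · have := min_le_left a₁ a₂; have := min_le_right a₁ a₂; nlinarith
  · have := le_max_left a₁ a₂; have := le_max_right a₁ a₂; nlinarith

include hs ht in
/-- Frame coordinates of `x + m • V'` (`V' = Pi.single k.rev t`): same column, row shifted by `m`.
[folklore] -/
theorem frame_add_zsmul (x : Site 2) (m : ℤ) :
    s * (x + m • (Pi.single k.rev t : Site 2)) k = s * x k ∧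
      t * (x + m • (Pi.single k.rev t : Site 2)) k.rev = t * x k.rev + m := by
  fin_cases k <;> rcases hs with rfl | rfl <;> rcases ht with rfl | rfl <;> simp <;> ring

end FrameVec

/-! ### The column-bottom function -/

section ColumnBottom

variable {G : ℝ → ℝ} {δ : ℝ} {N : ℤ → ℤ} (hδ : 0 < δ) (hN : ∀ j : ℤ, N j = ⌊G (δ * j) / δ⌋ + 1)

include hδ hN in
/-- `N j ≤ n` says `G (δ j) < δ n`. [folklore] -/
theorem N_le_iff (j n : ℤ) : N j ≤ n ↔ G (δ * j) < δ * n := by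
  rw [hN, Int.add_one_le_iff, Int.floor_lt, div_lt_iff₀ hδ, mul_comm (n : ℝ)]

include hδ hN in
/-- `G (δ j) < δ N j ≤ G (δ j) + δ`. [folklore] -/
theorem G_lt_and_le (j : ℤ) : G (δ * j) < δ * N j ∧ δ * N j ≤ G (δ * j) + δ := by
  refine ⟨(N_le_iff hδ hN j (N j)).1 le_rfl, ?_⟩
  rw [hN]
  push_cast
  have h := Int.floor_le (G (δ * j) / δ)
  have : δ * (⌊G (δ * ↑j) / δ⌋ : ℝ) ≤ δ * (G (δ * j) / δ) := mul_le_mul_of_nonneg_left h hδ.le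
  rw [mul_div_cancel₀ _ hδ.ne'] at this
  linarith

include hδ hN in
/-- `N` is monotone when `G` is. [folklore] -/
theorem N_monotone (hmono : Monotone G) : Monotone N := by
  intro i j hij
  rw [N_le_iff hδ hN]
  refine lt_of_le_of_lt (hmono ?_) (G_lt_and_le hδ hN j).1
  exact mul_le_mul_of_nonneg_left (by exact_mod_cast hij) hδ.le

end ColumnBottom


/-! ### The local epigraph analysis -/

section Local

variable {E : DiscreteDobrushin} {k : Fin 2} {s t : ℤ} {U V : ℂ} {G : ℝ → ℝ} {α R : ℝ} {p : ℂ}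
  {N : ℤ → ℤ}
  (hs : s = 1 ∨ s = -1) (ht : t = 1 ∨ t = -1)
  (hU : U = Site.toComplex (Pi.single k s)) (hV : V = Site.toComplex (Pi.single k.rev t))
  (hp : p = (α : ℂ) * U + ((G α : ℝ) : ℂ) * V)
  (hδ : 0 < E.δ) (hδR : 32 * E.δ ≤ R) (hmono : Monotone G) (hlip : ∀ a b, |G a - G b| ≤ |a - b|)
  (hepi : ∀ a b : ℝ, dist ((a : ℂ) * U + (b : ℂ) * V) p < R → ((a : ℂ) * U + (b : ℂ) * V ∈ E.Ω ↔ G a < b))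
  (hbulk : ∀ x : Site 2, |E.δ * (s * x k) - α| ≤ R / 4 → 3 * R / 8 ≤ E.δ * (t * x k.rev) - G α →
    E.δ * (t * x k.rev) - G α ≤ R / 2 → x ∈ meshDomain E.Ω E.δ)
  (hN : ∀ j : ℤ, N j = ⌊G (E.δ * j) / E.δ⌋ + 1)

include hs ht hU hV hδ hepi hN in
/-- **Mesh vertices near the mark are the epigraph sites**: for a site whose mesh point is within
`R` of `p`, `x ∈ meshVertices` iff `N (col x) ≤ row x`. [folklore] -/
theorem mem_meshVertices_iff_N_le {x : Site 2} (hx : dist (meshPoint E.δ x) p < R) :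
    x ∈ meshVertices E.Ω E.δ ↔ N (s * x k) ≤ t * x k.rev := by
  rw [mem_meshVertices_iff, N_le_iff hδ hN]
  push_cast
  rw [meshPoint_eq_frame hs ht hU hV] at hx ⊢
  exact hepi _ _ hx

include hs ht hU hV hp hδ hδR hepi in
/-- A frame point above a point of the window `B(p, R/4)`, up to the band, lies in `B(p, R)`, and
if above the graph also in `Ω`. [folklore] -/
theorem mem_of_above {a b b' : ℝ} (hab : dist ((a : ℂ) * U + (b : ℂ) * V) p < R / 4)
    (hbb' : b ≤ b') (hb' : b' - G α ≤ R / 2) :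
    dist ((a : ℂ) * U + (b' : ℂ) * V) p < R ∧ (G a < b' → (a : ℂ) * U + (b' : ℂ) * V ∈ E.Ω) := by
  have hR : 0 < R := by linarith
  have h1 : dist ((a : ℂ) * U + (b : ℂ) * V) p ^ 2 = (a - α) ^ 2 + (b - G α) ^ 2 := by
    rw [hp]; exact dist_sq_frame hs ht hU hV a b α (G α)
  have h2 : dist ((a : ℂ) * U + (b' : ℂ) * V) p ^ 2 = (a - α) ^ 2 + (b' - G α) ^ 2 := by
    rw [hp]; exact dist_sq_frame hs ht hU hV a b' α (G α)
  have hsq : dist ((a : ℂ) * U + (b : ℂ) * V) p ^ 2 < (R / 4) ^ 2 :=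
    pow_lt_pow_left₀ hab dist_nonneg two_ne_zero
  have hbα : -(R / 4) < b - G α := by
    have hb2 : (b - G α) ^ 2 < (R / 4) ^ 2 := by nlinarith [sq_nonneg (a - α)]
    exact (abs_lt.1 (abs_lt_of_sq_lt_sq hb2 (by positivity))).1
  have hlt : dist ((a : ℂ) * U + (b' : ℂ) * V) p < R := by
    refine lt_of_pow_lt_pow_left₀ 2 hR.le ?_
    rw [h2]; nlinarith [sq_nonneg (a - α)]
  exact ⟨hlt, fun hG => (hepi a b' hlt).2 hG⟩

include hs ht hU hV hp hδ hδR hepi hbulk hN in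
/-- **Epigraph sites near the mark are in the discrete domain `Ω_δ`**: a site of the window
`B(p, R/4)` with `N (col x) ≤ row x` is joined to the band above the mark by a vertical mesh path,
whose top is in `meshDomain` by the bulk input. [folklore] -/
theorem mem_meshDomain_of_N_le {x : Site 2} (hx : dist (meshPoint E.δ x) p < R / 4)
    (hNx : N (s * x k) ≤ t * x k.rev) : x ∈ meshDomain E.Ω E.δ := by
  have hGa : G (E.δ * (s * x k)) < E.δ * (t * x k.rev) := by
    have := (N_le_iff hδ hN _ _).1 hNx; push_cast at this; exact this
  rw [meshPoint_eq_frame hs ht hU hV] at hx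
  set a : ℝ := E.δ * (s * x k) with ha
  set b : ℝ := E.δ * (t * x k.rev) with hb
  have hR : 0 < R := by linarith
  have hdp : dist ((a : ℂ) * U + (b : ℂ) * V) p ^ 2 = (a - α) ^ 2 + (b - G α) ^ 2 := by
    rw [hp]; exact dist_sq_frame hs ht hU hV a b α (G α)
  have hsq : dist ((a : ℂ) * U + (b : ℂ) * V) p ^ 2 < (R / 4) ^ 2 :=
    pow_lt_pow_left₀ hx dist_nonneg two_ne_zero
  have haα : |a - α| ≤ R / 4 :=
    (abs_lt_of_sq_lt_sq (by nlinarith [sq_nonneg (b - G α)]) (by positivity)).le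
  have hbα : |b - G α| < R / 4 := abs_lt_of_sq_lt_sq (by nlinarith [sq_nonneg (a - α)]) (by positivity)
  -- number of vertical steps
  have hgap : 0 ≤ 3 * R / 8 - (b - G α) := by linarith [(abs_lt.1 hbα).2]
  set M : ℕ := ⌈(3 * R / 8 - (b - G α)) / E.δ⌉₊ with hM
  have hM1 : 3 * R / 8 ≤ b + E.δ * M - G α := by
    have h := Nat.le_ceil ((3 * R / 8 - (b - G α)) / E.δ)
    rw [← hM, div_le_iff₀ hδ] at h
    linarith
  have hM2 : b + E.δ * M - G α ≤ R / 2 := by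
    have h := Nat.ceil_lt_add_one (div_nonneg hgap hδ.le)
    rw [← hM] at h
    have : E.δ * (M : ℝ) < 3 * R / 8 - (b - G α) + E.δ := by
      have := mul_lt_mul_of_pos_left h hδ
      rwa [mul_add, mul_one, mul_div_cancel₀ _ hδ.ne'] at this
    linarith
  -- frame data of the sites `x + m • V'` of the vertical path
  have hpt : ∀ m : ℕ, meshPoint E.δ (x + (m : ℤ) • (Pi.single k.rev t : Site 2)) =
      (a : ℂ) * U + ((b + E.δ * m : ℝ) : ℂ) * V ∧
      (s : ℝ) * (x + (m : ℤ) • (Pi.single k.rev t : Site 2)) k = s * x k ∧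
      (t : ℝ) * (x + (m : ℤ) • (Pi.single k.rev t : Site 2)) k.rev = t * x k.rev + m := by
    intro m
    obtain ⟨hc, hr⟩ := frame_add_zsmul hs ht x (m : ℤ)
    have hcR : (s : ℝ) * (x + (m : ℤ) • (Pi.single k.rev t : Site 2)) k = s * x k := by
      exact_mod_cast hc
    have hrR : (t : ℝ) * (x + (m : ℤ) • (Pi.single k.rev t : Site 2)) k.rev = t * x k.rev + m := by
      exact_mod_cast hr
    refine ⟨?_, hcR, hrR⟩
    rw [meshPoint_eq_frame hs ht hU hV, hcR, hrR, ha, hb]; push_cast; ring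
  -- the vertical path, from the band downwards
  have key : ∀ d : ℕ, d ≤ M → x + ((M - d : ℕ) : ℤ) • (Pi.single k.rev t : Site 2) ∈ meshDomain E.Ω E.δ := by
    intro d
    induction d with
    | zero =>
      intro _
      obtain ⟨-, hc, hr⟩ := hpt (M - 0)
      refine hbulk _ ?_ ?_ ?_
      · rw [hc]; exact haα
      · rw [hr]; simp only [Nat.sub_zero]; rw [mul_add]; linarith
      · rw [hr]; simp only [Nat.sub_zero]; rw [mul_add]; linarith
    | succ d ih =>
      intro hd
      have ih' := ih (Nat.le_of_succ_le hd)
      set m : ℕ := M - (d + 1) with hm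
      have hMd : M - d = m + 1 := by omega
      rw [hMd] at ih'
      obtain ⟨hpt1, -, -⟩ := hpt m
      obtain ⟨hpt2, -, -⟩ := hpt (m + 1)
      have hmM : (m : ℝ) + 1 ≤ M := by
        have : m + 1 ≤ M := by omega
        exact_mod_cast this
      have hδm : 0 ≤ E.δ * m := by positivity
      have hab : ∀ b'' : ℝ, b ≤ b'' → b'' ≤ b + E.δ * (m + 1) →
          dist ((a : ℂ) * U + (b'' : ℂ) * V) p < R ∧ (a : ℂ) * U + (b'' : ℂ) * V ∈ E.Ω := by
        intro b'' h1 h2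
        have h := mem_of_above hs ht hU hV hp hδ hδR hepi hx h1 (by nlinarith)
        exact ⟨h.1, h.2 (hGa.trans_le h1)⟩
      refine mem_meshDomain_of_meshGraph_adj ih' ?_ (meshGraph_adj_iff.2 ⟨?_, ?_⟩)
      · -- the lower site is a mesh vertex
        rw [mem_meshVertices_iff, hpt1]
        exact (hab _ (by linarith) (by nlinarith)).2
      · -- lattice adjacency `y (m+1) ~ y m`
        rw [zdGraph_adj_iff]
        refine ⟨k.rev, ?_⟩
        have e : ((m + 1 : ℕ) : ℤ) • (Pi.single k.rev t : Site 2) =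
            (m : ℤ) • (Pi.single k.rev t : Site 2) + Pi.single k.rev t := by
          rw [show ((m + 1 : ℕ) : ℤ) = (m : ℤ) + 1 by push_cast; ring, add_zsmul, one_zsmul]
        rcases ht with rfl | rfl
        · right; rw [e, add_assoc]
        · left
          rw [e, add_assoc, add_assoc]
          congr 1
          rw [← Pi.single_add]
          simp
      · -- the closed vertical mesh edge lies in `Ω̄`
        rw [hpt2, hpt1]
        refine (segment_vert_subset (B := Set.univ) (a := a) (b₁ := b + E.δ * ((m + 1 : ℕ) : ℝ))
          (b₂ := b + E.δ * (m : ℝ)) convex_univ (mem_univ _) (mem_univ _)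
          fun b'' hb1 hb2 _ => ?_).trans subset_closure
        push_cast at hb1 hb2
        refine (hab b'' ?_ ?_).2
        · refine le_trans ?_ hb1
          rw [le_min_iff]; constructor <;> nlinarith
        · refine hb2.trans ?_
          rw [max_le_iff]; constructor <;> nlinarith
  simpa using key M le_rfl

end Local
end SmoothMark

/-! ### Registered sub-goal (one-line signature, verbatim) -/

/-- **Registered sub-goal `smoothMark_part2` of `stub_smoothMarkFamilies`**: epigraph sites near a smooth mark belong to the discrete domain `Ω_δ`. [folklore] -/
theorem smoothMark_part2 : ∀ (E : DiscreteDobrushin) (k : Fin 2) (s t : ℤ) (U V : ℂ) (G : ℝ → ℝ) (α R : ℝ) (p : ℂ) (N : ℤ → ℤ), (s = 1 ∨ s = -1) → (t = 1 ∨ t = -1) → U = Site.toComplex (Pi.single k s) → V = Site.toComplex (Pi.single k.rev t) → p = (α : ℂ) * U + ((G α : ℝ) : ℂ) * V → 0 < E.δ → 32 * E.δ ≤ R → (∀ a b : ℝ, dist ((a : ℂ) * U + (b : ℂ) * V) p < R → ((a : ℂ) * U + (b : ℂ) * V ∈ E.Ω ↔ G a < b)) → (∀ x : Site 2, |E.δ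 * (s * x k) - α| ≤ R / 4 → 3 * R / 8 ≤ E.δ * (t * x k.rev) - G α → E.δ * (t * x k.rev) - G α ≤ R / 2 → x ∈ meshDomain E.Ω E.δ) → (∀ j : ℤ, N j = ⌊G (E.δ * j) / E.δ⌋ + 1) → ∀ x : Site 2, dist (meshPoint E.δ x) p < R / 4 → N (s * x k) ≤ t * x k.rev → x ∈ meshDomain E.Ω E.δ :=
  fun _ _ _ _ _ _ _ _ _ _ _ hs ht hU hV hp hδ hδR hepi hbulk hN _ hx hNx =>
    SmoothMark.mem_meshDomain_of_N_le hs ht hU hV hp hδ hδR hepi hbulk hN hx hNx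

end Summit.CriticalPhenomena.CardyFormulaZ2.Cruxes.SLESixFamiliesGiveCardy.CollarTouchSandwich

end
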